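import Literature.Analysis.FluidPDE.CylindricalGenerator
import Literature.Analysis.FunctionSpaces.TorusSpaceTimeFields
import Mathlib.MeasureTheory.Integral.IntervalIntegral.AbsolutelyContinuousFun
import Mathlib.MeasureTheory.Integral.IntervalIntegral.LebesgueDifferentiationThm
import Mathlib.Analysis.Calculus.MeanValue
import HarnessLib

/-!
# Cylindrical functionals along a Leray–Hopf trajectory: the chain rule in integral form

Analysis/FluidPDE support file for the discharge of
`Literature.Analysis.FluidPDE.timeAverage_isStationary` (Foias–Manley–Rosa–Temam 2001, Ch. IV
Thm. 3.1). The Liouville equation (1.30) for a time-average measure rests on the identity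
(FMRT 2001, App. B.2, (B.18)–(B.19), PDF pp. 256–259)

  `Φ(u(b)) - Φ(u(a)) = ∫ₐᵇ ⟨F(u(t)), Φ'(u(t))⟩ dt`

for a cylindrical test functional `Φ(u) = φ((u,g₁),…,(u,gₘ))` along a weak solution. FMRT prove
it for general `Φ ∈ 𝒯` through `Φ_m = Φ ∘ P_m`, the mean value theorem and absolute continuity of
`u` in `V'`; for the tree's cylindrical class all derivatives fall on the smooth `gᵢ`, and the
identity follows from the **time-sliced weak formulation**
`(u(t), gᵢ) - (u(s), gᵢ) = ∫ₛᵗ Fluxᵢ` (`Torus.IsLerayHopfOn.integral_inner_sub_eq_setIntegral`,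
`LerayHopfTimeSliceTorus`) by one-variable calculus: the coordinates `t ↦ (u(t), gᵢ)` are
absolutely continuous, `φ ∈ C¹_c` is Lipschitz, so `t ↦ Φ(u(t))` is absolutely continuous with
a.e. derivative `∑ᵢ ∂ᵢφ · Fluxᵢ = ⟨F(u(t)), Φ'(u(t))⟩` (Lebesgue's differentiation theorem and
the chain rule), and Mathlib's fundamental theorem of calculus for absolutely continuous
functions (`AbsolutelyContinuousOnInterval.integral_deriv_eq_sub`) integrates it.

Contents (`u` a global Leray–Hopf solution on `T^d` with steady force `F ∈ L²`, slices lifted to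
`U t ∈ H`, `U t = u t` a.e. for `t ≥ 0`):

* `trajFlux ν F u g` — the flux `s ↦ ∫ (⟪u, (u·∇)g⟫ + ν ⟪u, Δg⟫ + ⟪F, g⟫)`; its integrability
  on every `(0, T)`; `pairing_lift_sub_eq_integral_trajFlux` — `(U t, g) - (U s, g) = ∫ₛᵗ flux`;
  `nsGeneratorPairing_lift_eq_trajFlux`, `nsGeneratorPairing_grad_lift_eq_sum` — along the
  lifted trajectory the tested generator is `∑ᵢ ∂ᵢφ(coords) fluxᵢ`;
* a private copy of the closure property `LipschitzWith.comp_absolutelyContinuousOnInterval`;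
* `CylindricalTest.lipschitzWith`, `CylindricalTest.exists_abs_eval_le` — `φ ∈ C¹_c` is
  Lipschitz and bounded;
* `IsGlobalLerayHopf.cylindrical_eval_sub_eq_integral` — **the chain rule in integral form**
  `Φ(U b) - Φ(U a) = ∫ₐᵇ ⟨F(U t), Φ'(U t)⟩ dt` for `0 < a ≤ b`.

## Mathlib / tree search

Used from Mathlib: `IntervalIntegrable.absolutelyContinuousOnInterval_intervalIntegral`,
`AbsolutelyContinuousOnInterval.integral_deriv_eq_sub`, `IntervalIntegrable.ae_hasDerivAt_integral`,
`lipschitzWith_of_nnnorm_fderiv_le`, `HasDerivAt.fun_sum`,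
`AEStronglyMeasurable.comp_snd`; from the tree `Torus.IsLerayHopfOn.integral_inner_sub_eq_setIntegral`,
`…integrableOn_flux` (`LerayHopfTimeSliceTorus`), `Torus.aestronglyMeasurable_stLift_of_uncurry`
(`TorusSpaceTimeFields`), and `CylindricalGenerator`. No chain rule for absolutely continuous
vector curves exists in Mathlib (only the scalar product rule
`AbsolutelyContinuousOnInterval.integral_deriv_mul_eq_sub`).

## References

* C. Foias, O. Manley, R. Rosa, R. Temam, *Navier–Stokes Equations and Turbulence*, Cambridge
  Univ. Press (2001), App. IV.B.2, (B.18)–(B.19), (B.24)–(B.28) (PDF pp. 256–259). [FMRT2001]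
-/

noncomputable section

open MeasureTheory Set Filter Topology UnitAddTorus
open scoped InnerProductSpace RealInnerProductSpace ENNReal NNReal

namespace Literature.Analysis.FluidPDE.Torus

variable {d : Type*} [Fintype d] [DecidableEq d]

/-- Local notation for the real Hilbert space `L²(T^d; ℝ^d)`. -/
local notation "L2T " d':max => Lp (EuclideanSpace ℝ d') 2 (volume : Measure (UnitAddTorus d'))

/-- Local notation for real vector fields `T^d → ℝ^d`. -/
local notation "Vec " d':max => UnitAddTorus d' → EuclideanSpace ℝ d'

/-! ### A steady `L²` force as a space–time datum -/

section Steady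

omit [DecidableEq d] in
/-- The space–time lift of a steady a.e.-strongly measurable field is a.e. strongly measurable on
every `S × ℝ^d` (the time slice map is quasi measure preserving,
`Torus.aestronglyMeasurable_stLift_of_uncurry`). [folklore] -/
theorem aestronglyMeasurable_stLift_steady' {F : Vec d} (hF : AEStronglyMeasurable F volume) (S : Set ℝ) :
    AEStronglyMeasurable (FunctionSpaces.Torus.stLift (fun _ : ℝ => F))
      (volume.restrict (S ×ˢ (univ : Set (EuclideanSpace ℝ d)))) :=
  FunctionSpaces.Torus.aestronglyMeasurable_stLift_of_uncurry (u := fun _ : ℝ => F) hF.comp_snd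

omit [DecidableEq d] in
/-- A steady `L²` field has finite space–time `L²` mass on every `(0, T) × T^d`. [folklore] -/
theorem lintegral_enorm_sq_steady_lt_top {F : Vec d} (hF : MemLp F 2 volume) (T : ℝ) :
    ∫⁻ _ in Ioo (0 : ℝ) T, ∫⁻ x, ‖F x‖ₑ ^ 2 < ⊤ := by
  rw [setLIntegral_const]
  refine ENNReal.mul_lt_top ?_ measure_Ioo_lt_top
  have h := lintegral_rpow_enorm_lt_top_of_eLpNorm_lt_top two_ne_zero ENNReal.ofNat_ne_top
    hF.eLpNorm_lt_top
  simpa only [ENNReal.toReal_ofNat, ENNReal.rpow_ofNat] using h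

end Steady

/-! ### The flux along the trajectory and the coordinates of the lift -/

section Trajectory

variable {ν : ℝ} {F u₀ : Vec d} {u : ℝ → Vec d} {U : ℝ → FunctionSpaces.Torus.energySpace d}

/-- The **flux** of a field `g` along a velocity `u : ℝ → (T^d → ℝ^d)` with steady force `F`:
`s ↦ ∫ (⟪u(s), (u(s)·∇)g⟫ + ν ⟪u(s), Δg⟫ + ⟪F, g⟫)`, the integrand of the time-sliced weak
formulation `(u(t), g) - (u(s), g) = ∫ₛᵗ flux` (Temam 1984, Ch. III (1.25); FMRT 2001, Ch. IV
(1.7)). Junk value `0` of the Bochner integral at times where the integrand is not integrable. [cite: FMRT2001, Ch. IV §1.1 (1.7)] -/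
def trajFlux (ν : ℝ) (F : Vec d) (u : ℝ → Vec d) (g : Vec d) (s : ℝ) : ℝ :=
  ∫ x, (⟪u s x, FunctionSpaces.Torus.convect (u s) g x⟫ + ν * ⟪u s x, FunctionSpaces.Torus.laplacian g x⟫ + ⟪F x, g x⟫)

/-- The flux of a smooth field along a global Leray–Hopf solution with steady `L²` force is
integrable on every `(0, T)` (`Torus.IsLerayHopfOn.integrableOn_flux`). [folklore] -/
theorem IsGlobalLerayHopf.integrableOn_trajFlux (hF : MemLp F 2 volume)
    (hu : IsGlobalLerayHopf ν (fun _ => F) u₀ u) {g : Vec d} (hg : FunctionSpaces.Torus.IsSmooth g) {T : ℝ}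
    (hT : 0 < T) : IntegrableOn (trajFlux ν F u g) (Ioo 0 T) :=
  (hu T hT).integrableOn_flux (aestronglyMeasurable_stLift_steady' hF.1 _)
    (lintegral_enorm_sq_steady_lt_top hF T) hg

/-- The flux is interval integrable on `[a, b]` for `0 ≤ a ≤ b`. [folklore] -/
theorem IsGlobalLerayHopf.intervalIntegrable_trajFlux (hF : MemLp F 2 volume)
    (hu : IsGlobalLerayHopf ν (fun _ => F) u₀ u) {g : Vec d} (hg : FunctionSpaces.Torus.IsSmooth g) {a b : ℝ}
    (ha : 0 ≤ a) (hab : a ≤ b) : IntervalIntegrable (trajFlux ν F u g) volume a b := by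
  rw [intervalIntegrable_iff_integrableOn_Ioo_of_le hab]
  exact (hu.integrableOn_trajFlux hF hg (by linarith : 0 < b + 1)).mono_set
    (Ioo_subset_Ioo ha (by linarith))

/-- The `L²` pairing of the lift with a field is the pairing of the slice. [folklore] -/
theorem pairing_lift_eq (hU : ∀ t, 0 ≤ t → ((U t : L2T d) : Vec d) =ᵐ[volume] u t) (g : Vec d)
    {t : ℝ} (ht : 0 ≤ t) : pairing (U t : L2T d) g = ∫ x, ⟪u t x, g x⟫ :=
  integral_congr_ae ((hU t ht).mono fun x hx => by simp only [hx])

/-- **The time-sliced weak formulation in the energy space**: for a smooth divergence-free `g`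
and `0 < s ≤ t`, `(U t, g) - (U s, g) = ∫ₛᵗ flux` (`Torus.IsLerayHopfOn.integral_inner_sub_eq_setIntegral`;
Temam 1984, Ch. III (1.25); FMRT 2001, Ch. IV (1.7)). [cite: FMRT2001, Ch. IV §1.1 (1.7)] -/
theorem IsGlobalLerayHopf.pairing_lift_sub_eq_integral_trajFlux (hF : MemLp F 2 volume)
    (hu : IsGlobalLerayHopf ν (fun _ => F) u₀ u)
    (hU : ∀ t, 0 ≤ t → ((U t : L2T d) : Vec d) =ᵐ[volume] u t) {g : Vec d} (hg : FunctionSpaces.Torus.IsSmooth g)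
    (hdiv : FunctionSpaces.Torus.IsDivFree g) {s t : ℝ} (hs : 0 < s) (hst : s ≤ t) :
    pairing (U t : L2T d) g - pairing (U s : L2T d) g = ∫ τ in s..t, trajFlux ν F u g τ := by
  rw [pairing_lift_eq hU g (hs.le.trans hst), pairing_lift_eq hU g hs.le,
    intervalIntegral.integral_of_le hst]
  exact (hu t (hs.trans_le hst)).integral_inner_sub_eq_setIntegral (hs.trans_le hst)
    (aestronglyMeasurable_stLift_steady' hF.1 _) (lintegral_enorm_sq_steady_lt_top hF t) hg hdiv
    hs hst le_rfl

/-- Along the lifted trajectory the tested generator of a smooth field is its flux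
(`Torus.nsGeneratorPairing_eq_flux`). [folklore] -/
theorem nsGeneratorPairing_lift_eq_trajFlux (hF : MemLp F 2 volume)
    (hU : ∀ t, 0 ≤ t → ((U t : L2T d) : Vec d) =ᵐ[volume] u t) {g : Vec d} (hg : FunctionSpaces.Torus.IsSmooth g)
    {t : ℝ} (ht : 0 ≤ t) : nsGeneratorPairing ν F (U t) g = trajFlux ν F u g t :=
  nsGeneratorPairing_eq_flux ν hF hg (hU t ht)

/-- Along the lifted trajectory the tested generator of a cylindrical functional is
`∑ᵢ ∂ᵢφ(coords (U t)) fluxᵢ(t)` (FMRT 2001, App. B.2 (B.18)). [cite: FMRT2001, App. B.2 (B.18)] -/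
theorem nsGeneratorPairing_grad_lift_eq_sum (hF : MemLp F 2 volume)
    (hU : ∀ t, 0 ≤ t → ((U t : L2T d) : Vec d) =ᵐ[volume] u t) (Φ : CylindricalTest d) {t : ℝ}
    (ht : 0 ≤ t) :
    nsGeneratorPairing ν F (U t) (Φ.grad (U t)) =
      ∑ i, _root_.fderiv ℝ Φ.φ (Φ.coords (U t)) (EuclideanSpace.single i 1) * trajFlux ν F u (Φ.g i) t := by
  rw [nsGeneratorPairing_grad ν (hF.integrable one_le_two) Φ (U t)]
  exact Finset.sum_congr rfl fun i _ => by
    rw [nsGeneratorPairing_lift_eq_trajFlux hF hU (Φ.g_smooth i) ht]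

end Trajectory

/-! ### Lipschitz functions of absolutely continuous curves -/

section Lipschitz

/-- **A Lipschitz function of an absolutely continuous curve is absolutely continuous**
(immediate from the definition: `∑ dist (φ(γ aⱼ)) (φ(γ bⱼ)) ≤ K ∑ dist (γ aⱼ) (γ bⱼ)`). The same
statement is `LipschitzWith.comp_absolutelyContinuousOnInterval` of `TaoLocalisedEnstrophy`; a
private copy keeps the imports of this file light. [folklore] -/
private theorem lipschitzWith_comp_absolutelyContinuousOnInterval {X Y : Type*} [PseudoMetricSpace X]
    [PseudoMetricSpace Y] {φ : X → Y} {K : ℝ≥0} (hφ : LipschitzWith K φ) {γ : ℝ → X} {a b : ℝ}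
    (hγ : AbsolutelyContinuousOnInterval γ a b) : AbsolutelyContinuousOnInterval (φ ∘ γ) a b := by
  unfold AbsolutelyContinuousOnInterval at hγ ⊢
  have h := hγ.const_mul (K : ℝ)
  rw [mul_zero] at h
  refine squeeze_zero (fun E => Finset.sum_nonneg fun i _ => dist_nonneg) (fun E => ?_) h
  rw [Finset.mul_sum]
  exact Finset.sum_le_sum fun i _ => hφ.dist_le_mul _ _

/-- The profile `φ ∈ C¹_c(ℝ^m)` of a cylindrical test functional is Lipschitz (bounded
derivative and the mean value inequality). [folklore] -/
theorem CylindricalTest.lipschitzWith (Φ : CylindricalTest d) : ∃ K : ℝ≥0, LipschitzWith K Φ.φ := by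
  obtain ⟨M, hM⟩ := (Φ.φ_contDiff.continuous_fderiv one_ne_zero).bounded_above_of_compact_support
    (Φ.φ_compact.fderiv (𝕜 := ℝ))
  refine ⟨⟨max M 0, le_max_right _ _⟩, lipschitzWith_of_nnnorm_fderiv_le
    (Φ.φ_contDiff.differentiable one_ne_zero) fun x => ?_⟩
  rw [← NNReal.coe_le_coe, coe_nnnorm]
  exact (hM x).trans (le_max_left _ _)

/-- A cylindrical test functional is bounded: `|Φ(u)| ≤ M` (`φ ∈ C_c`). [folklore] -/
theorem CylindricalTest.exists_abs_eval_le (Φ : CylindricalTest d) :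
    ∃ M : ℝ, ∀ u : FunctionSpaces.Torus.energySpace d, |Φ.eval u| ≤ M := by
  obtain ⟨M, hM⟩ := Φ.φ_contDiff.continuous.bounded_above_of_compact_support Φ.φ_compact
  exact ⟨M, fun u => by rw [← Real.norm_eq_abs]; exact hM _⟩

end Lipschitz

/-! ### The chain rule in integral form -/

section ChainRule

variable {ν : ℝ} {F u₀ : Vec d} {u : ℝ → Vec d} {U : ℝ → FunctionSpaces.Torus.energySpace d}

omit [Fintype d] [DecidableEq d] in
/-- `‖∑ᵢ cᵢ eᵢ‖ ≤ ∑ᵢ |cᵢ|` for the standard unit vectors `eᵢ` of `ℝ^m`. [folklore] -/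
theorem norm_sum_smul_single_le {m : ℕ} (c : Fin m → ℝ) :
    ‖∑ i, c i • EuclideanSpace.single i (1 : ℝ)‖ ≤ ∑ i, |c i| := by
  refine (norm_sum_le _ _).trans (le_of_eq (Finset.sum_congr rfl fun i _ => ?_))
  rw [norm_smul, Real.norm_eq_abs]
  simp

omit [Fintype d] [DecidableEq d] in
/-- A vector of `ℝ^m` is the combination of the standard unit vectors with its coordinates. [folklore] -/
theorem eq_sum_coord_smul_single {m : ℕ} (v : EuclideanSpace ℝ (Fin m)) :
    v = ∑ i, v i • EuclideanSpace.single i (1 : ℝ) := by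
  have h := (EuclideanSpace.basisFun (Fin m) ℝ).sum_repr v
  simp only [EuclideanSpace.basisFun_apply, EuclideanSpace.basisFun_repr] at h
  exact h.symm

/-- **The chain rule along a Leray–Hopf trajectory, integral form** (FMRT 2001, App. B.2,
(B.18)–(B.19)): for a cylindrical test functional `Φ`, a global Leray–Hopf solution `u` on `T^d`
with steady force `F ∈ L²` lifted to `U t ∈ H`, and `0 < a ≤ b`,
`Φ(U b) - Φ(U a) = ∫ₐᵇ ⟨F(U t), Φ'(U t)⟩ dt`.
Proof: the coordinates `t ↦ (U t, gᵢ) = (U a, gᵢ) + ∫ₐᵗ fluxᵢ` are absolutely continuous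
(time-sliced weak formulation), `φ` is Lipschitz, so `t ↦ Φ(U t)` is absolutely continuous on
`[a, b]` with a.e. derivative `∑ᵢ ∂ᵢφ(coords) fluxᵢ = ⟨F(U t), Φ'(U t)⟩` (Lebesgue differentiation
and the chain rule), and the fundamental theorem of calculus for absolutely continuous functions
applies. [cite: FMRT2001, App. B.2 (B.18)–(B.19)] -/
theorem IsGlobalLerayHopf.cylindrical_eval_sub_eq_integral (hF : MemLp F 2 volume)
    (hu : IsGlobalLerayHopf ν (fun _ => F) u₀ u)
    (hU : ∀ t, 0 ≤ t → ((U t : L2T d) : Vec d) =ᵐ[volume] u t) (Φ : CylindricalTest d) {a b : ℝ}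
    (ha : 0 < a) (hab : a ≤ b) :
    Φ.eval (U b) - Φ.eval (U a) = ∫ t in a..b, nsGeneratorPairing ν F (U t) (Φ.grad (U t)) := by
  -- fluxes and their primitives from `a`
  set fl : Fin Φ.m → ℝ → ℝ := fun i => trajFlux ν F u (Φ.g i) with hfl
  have hfl_int : ∀ i, IntervalIntegrable (fl i) volume a b := fun i =>
    hu.intervalIntegrable_trajFlux hF (Φ.g_smooth i) ha.le hab
  set G : Fin Φ.m → ℝ → ℝ := fun i t => ∫ s in a..t, fl i s with hG
  -- the coordinates along the trajectory
  have hcoord : ∀ i, ∀ t ∈ Icc a b, Φ.coords (U t) i = Φ.coords (U a) i + G i t := by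
    intro i t ht
    have h := hu.pairing_lift_sub_eq_integral_trajFlux hF hU (Φ.g_smooth i) (Φ.g_divFree i) ha ht.1
    show pairing (U t : L2T d) (Φ.g i) = pairing (U a : L2T d) (Φ.g i) + ∫ s in a..t, fl i s
    linarith
  -- the curve rebuilt from the primitives, and the functional along it
  set γ : ℝ → EuclideanSpace ℝ (Fin Φ.m) := fun t =>
    Φ.coords (U a) + ∑ i, G i t • EuclideanSpace.single i (1 : ℝ) with hγ
  have hγ_eq : ∀ t ∈ Icc a b, γ t = Φ.coords (U t) := by
    intro t ht
    have e1 := eq_sum_coord_smul_single (Φ.coords (U t))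
    have e2 := eq_sum_coord_smul_single (Φ.coords (U a))
    rw [e1, hγ]
    dsimp only
    conv_lhs => rw [e2]
    rw [← Finset.sum_add_distrib]
    refine Finset.sum_congr rfl fun i _ => ?_
    rw [hcoord i t ht, add_smul]
  set h : ℝ → ℝ := fun t => Φ.φ (γ t) with hh
  -- `h` is absolutely continuous on `[a, b]`
  obtain ⟨K, hK⟩ := Φ.lipschitzWith
  have hGac : ∀ i, AbsolutelyContinuousOnInterval (G i) a b := fun i =>
    (hfl_int i).absolutelyContinuousOnInterval_intervalIntegral left_mem_uIcc
  have hγac : AbsolutelyContinuousOnInterval γ a b := by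
    unfold AbsolutelyContinuousOnInterval at hGac ⊢
    have hsum := tendsto_finsetSum Finset.univ fun i (_ : i ∈ Finset.univ) => hGac i
    rw [Finset.sum_const_zero] at hsum
    refine squeeze_zero (fun E => Finset.sum_nonneg fun j _ => dist_nonneg) (fun E => ?_) hsum
    rw [Finset.sum_comm]
    refine Finset.sum_le_sum fun j _ => ?_
    rw [dist_eq_norm]
    have hsub : γ (E.2 j).1 - γ (E.2 j).2 =
        ∑ i, (G i (E.2 j).1 - G i (E.2 j).2) • EuclideanSpace.single i (1 : ℝ) := by
      simp only [hγ, add_sub_add_left_eq_sub, ← Finset.sum_sub_distrib, sub_smul]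
    rw [hsub]
    refine (norm_sum_smul_single_le _).trans (le_of_eq (Finset.sum_congr rfl fun i _ => ?_))
    rw [Real.dist_eq]
  have hac : AbsolutelyContinuousOnInterval h a b := lipschitzWith_comp_absolutelyContinuousOnInterval hK hγac
  -- the a.e. derivative of `h`
  have hae : ∀ᵐ t, t ∈ uIcc a b → ∀ i, HasDerivAt (G i) (fl i t) t := by
    have hi : ∀ i, ∀ᵐ t, t ∈ uIcc a b → HasDerivAt (G i) (fl i t) t := fun i =>
      ((hfl_int i).ae_hasDerivAt_integral).mono fun t ht hmem => ht hmem a left_mem_uIcc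
    exact (eventually_all.2 hi).mono fun t ht hmem i => ht i hmem
  have hderiv : ∀ᵐ t, t ∈ uIcc a b →
      HasDerivAt h (∑ i, fl i t * _root_.fderiv ℝ Φ.φ (γ t) (EuclideanSpace.single i 1)) t := by
    filter_upwards [hae] with t ht hmem
    have hγ' : HasDerivAt γ (∑ i, fl i t • EuclideanSpace.single i (1 : ℝ)) t := by
      have hs := HasDerivAt.fun_sum (u := Finset.univ)
        fun i (_ : i ∈ Finset.univ) => (ht hmem i).smul_const (EuclideanSpace.single i (1 : ℝ))
      have hs' := hs.const_add (Φ.coords (U a))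
      rw [hγ]
      exact hs'
    have hφ' : HasFDerivAt Φ.φ (_root_.fderiv ℝ Φ.φ (γ t)) (γ t) :=
      ((Φ.φ_contDiff.differentiable one_ne_zero) _).hasFDerivAt
    have hcomp := hφ'.comp_hasDerivAt t hγ'
    have hval : _root_.fderiv ℝ Φ.φ (γ t) (∑ i, fl i t • EuclideanSpace.single i (1 : ℝ)) =
        ∑ i, fl i t * _root_.fderiv ℝ Φ.φ (γ t) (EuclideanSpace.single i 1) := by
      rw [map_sum]
      exact Finset.sum_congr rfl fun i _ => by rw [map_smul, smul_eq_mul]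
    rw [← hval]
    exact hcomp
  -- the fundamental theorem of calculus for the absolutely continuous `h`
  have hFTC := hac.integral_deriv_eq_sub
  have hderiv_eq : ∀ᵐ t, t ∈ Set.uIoc a b → deriv h t = nsGeneratorPairing ν F (U t) (Φ.grad (U t)) := by
    filter_upwards [hderiv] with t ht hmem
    rw [uIoc_of_le hab] at hmem
    have hmem' : t ∈ Icc a b := ⟨hmem.1.le, hmem.2⟩
    have hmem'' : t ∈ uIcc a b := by rw [uIcc_of_le hab]; exact hmem'
    rw [(ht hmem'').deriv, nsGeneratorPairing_grad_lift_eq_sum hF hU Φ (ha.le.trans hmem'.1),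
      hγ_eq t hmem']
    exact Finset.sum_congr rfl fun i _ => mul_comm _ _
  have hb : h b = Φ.eval (U b) := by
    show Φ.φ (γ b) = Φ.φ (Φ.coords (U b))
    rw [hγ_eq b ⟨hab, le_rfl⟩]
  have ha' : h a = Φ.eval (U a) := by
    show Φ.φ (γ a) = Φ.φ (Φ.coords (U a))
    rw [hγ_eq a ⟨le_rfl, hab⟩]
  rw [← hb, ← ha', ← hFTC]
  exact intervalIntegral.integral_congr_ae hderiv_eq

end ChainRule

end Literature.Analysis.FluidPDE.Torus
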